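import Summits.BirchSwinnertonDyer.BirchSwinnertonDyer.Theorems.PrintCFramBottomClassIndexLawFiveLeSelmerDevissageCountRationalAligned
import Summits.BirchSwinnertonDyer.BirchSwinnertonDyer.Theorems.PrintCFramBottomClassIndexLawFiveLeLevelDictionaryBetaRankZero
import Summits.BirchSwinnertonDyer.BirchSwinnertonDyer.Theorems.PrintCFramBottomClassIndexLawFiveLeLevelDictionaryLocalInputs
import Summits.BirchSwinnertonDyer.BirchSwinnertonDyer.Theorems.PrintCFramBottomClassIndexLawFiveLeParitySplitRegistrable
import HarnessLib

/-!
# Route `PrintCFram`, crux C2 `BottomClassIndexLawFiveLe` (stmt-BirchSwinnertonDyer-20372), line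
# `eisenstein-resource-bdp-line` (registry v19, stub B1 `stub_bsdp_of_classFactor`): **THE LOWER BOUND OF THE SELMER COUNT** —
# CO-ALIGNED ⟹ `R_rel(Φ) ↪ Sel_p(W/K)`, hence `#R_rel(Φ) ≥ p² ⟹ Ш(W)[p] ≠ 0` in rank one (the B1-sha locus)
# (cell `bsd-print-cfram`, width seat `bsd-line-cfram-p1-w2` g10; helper `--supports` 20372; 0 defs, 0 facts, 0 sorry)

HONEST FRAMING. Nothing about BSD is proved here and no stub is closed. Seat g9's files bound `#Sel_p(W/ℚ)` from ABOVE by the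
residual groups `R_•(Φ.Quot)`, `R_•(Φ.Sub)` of the two characters of the rational line (dévissage). This file is the LOWER half:
the relaxed residual group of the SUB injects into the Selmer group as soon as the member is **CO-ALIGNED at `p` along `Φ`** :=
«every `Φ`-valued global class satisfies the Selmer local condition at the place(s) above `p`» — the cohomological face of LEAD g10's
geometric alignment `L_p = ℓ_S` (report §2(a)): `ℓ_S ⊆ L_p`, i.e. `H¹(ℚ_p, Φ) → H¹(ℚ_p, W[p]) → H¹(ℚ_p, W)` is zero, i.e.
`H¹(ℚ_p, W)[φ] = 0` for the isogeny `φ` with kernel `Φ` — by Tate local duality the same event as «`φ̂ : W'(ℚ_p) → W(ℚ_p)` is onto»,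
by the local Euler characteristic (`dim H¹(ℚ_p, 𝔽_p(θ_S)) = 1` for `θ_S|_{D_p} ∉ {1, ω}`) the same event as seat g9's ALIGNED in the
`res(Sel_p)` sense; neither identification is used or claimed here (CO-ALIGNED is carried as a hypothesis, like CASE S / ALIGNED in
`…SelmerCountCaseS`).

Notation as in the lane: `Γ = Γ_K`, `M = W[p]`, `Φ : StableSubgroup Γ M` (sub `Φ.Sub`, quotient `Φ.Quot`), `S_p = {v ∣ p}`,
`R_rel(A) = h1Unramified A S_p` (classes that are coboundaries on every `I_𝔓`, `𝔓 ∤ p`).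

* §1 **`incl_mem_selmerGroup_of_coaligned`** (any number field `K`, `p` odd) — `w : Γ_K → Φ.Sub` a continuous crossed homomorphism,
  a coboundary on `I_𝔓` for every `𝔓 ∤ p`; `W(K_v)[p] = 0` at the bad `v ∤ p`; `[Φ.incl ∘ w]` satisfies the Selmer condition at every
  `v ∣ p` ⊢ `[Φ.incl ∘ w] ∈ Sel_p(W/K)` (good `v ∤ p`: unramified = Kummer, X11b via w4 g8's `mem_selmerLocalKer_of_coboundaryOn_inertia_of_good`;
  bad `v ∤ p`: `H¹(K_v, W[p]) = 0`; infinite: `p` odd).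
* §2 **`natCard_h1Unramified_le_natCard_selmerGroup_of_coaligned`** — + `Φ.Quot^{Γ_K} = 0` (injectivity of `ι_*`) ⊢
  **`#R_rel(Φ.Sub) ≤ #Sel_p(W/K)`**; in dimensions `dim Sel_p(W) ≥ u_rel(θ_S)`.
* §3 (over `ℚ`, rank one) **`exists_sha_ne_zero_of_coaligned_of_sq_le`** — `rank W(ℚ) = 1`, `W(ℚ)[p] = 0`, CO-ALIGNED, `Φ.Quot^{Γ} = 0`,
  bad-place input, and **`p² ≤ #R_rel(Φ.Sub)`** ⊢ `Ш(W/ℚ)` has a NON-ZERO element killed by `p` (`#Sel_p = p · #Ш[p]`, w3 g8's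
  `ParitySplit.natCard_selmerGroup_eq_mul_of_rank_one`); **`exists_sha_ne_zero_of_coaligned_of_sq_le_of_cmRamified`** — the same on the
  CM-ramified class with its landed inputs (`W(ℚ)[p] = 0`, `W(ℚ_ℓ)[p] = 0` at bad `ℓ ≠ p`, `Φ.Quot^Γ = 0` for a line of order `p`).
  READING FOR B1 (seat notes w2g8 §4, w2g9 §2): on the model `W_ψ` (odd SUB character) in CASE R (co-aligned), `R_rel(ψ)` contains the
  Mazur–Wiles class and — when the EVEN constituent is irregular — a second, ramified-at-`p`, direction (`u_rel(ψ) = 1 + u_str(θ_e)`,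
  Greenberg–Wiles; not in the tree); then `#R_rel ≥ p²` and the member is on LEAD g11's B1-sha branch (`Ш(W_ψ)[p] ≠ 0`): the
  complement of `…SelmerCountCaseS` ∪ `…SelmerCountEvenRegular`.

THEOREMS ONLY; no definition, no named fact, no `sorry`. BSD is not proved by any of this; no summit statement is proved by this seat.
References: [SilvermanAEC2009] VIII.§2, X.§4 (Thm. 4.2, Cor. 4.4); [MilneADT2006] I.§3 (Cor. 3.4, Prop. 3.8), I.§6;
[SerreGaloisCohomology1997] I.§2.6 (b), I.§5.1, II.§1.1; [GreenbergLNM1716] §3; [Wiles1995] Prop. 1.6 (the Greenberg–Wiles formula,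
cited for the reading only); the LEAD g10 report §2 and seat notes w2g8 §4, w2g9 §2–§3.
-/

set_option autoImplicit false
-- `…BirchSwinnertonDyer.BirchSwinnertonDyer.Theorems…` is the problem's mandated namespace (D-0017).
set_option linter.dupNamespace false

noncomputable section

open scoped Classical

namespace Summit.BirchSwinnertonDyer.BirchSwinnertonDyer.Theorems.PrintCFram.SelmerCount

open NumberField IsDedekindDomain Field WeierstrassCurve
open Literature.NumberTheory.EllipticCurves Literature.NumberTheory.GaloisRepresentations
  Literature.NumberTheory.EllipticCurves.GreenbergSelmer Literature.NumberTheory.EllipticCurves.Rank1Residual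
open Summit.BirchSwinnertonDyer.BirchSwinnertonDyer.Theorems.PrintCFram.LevelDictionary
open Summit.BirchSwinnertonDyer.Rank1Residual.X2.ResidualDevissageModules

/-! ## §1 A `Φ`-valued class unramified outside `p` and Selmer at `p` is a Selmer class -/

section AnyField

variable {K : Type} [Field K] [NumberField K] (W : WeierstrassCurve K) [W.IsElliptic]

/-- **CO-ALIGNED ⟹ the push-forward of a relaxed `Φ`-class is a Selmer class.** `K` a number field, `W/K` elliptic, `p` an ODD prime,
`Φ ≤ W[p]` a `Γ_K`-stable subgroup, `w : Γ_K → Φ.Sub` a continuous crossed homomorphism which is a coboundary on the inertia group `I_𝔓`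
of every prime `𝔓` of `\bar ℤ_K` above a place `v ∤ p`. ASSUME `W(K_v)[p] = 0` at every BAD place `v ∤ p`, and that the push-forward
`ξ = [Φ.incl ∘ w] ∈ H¹(K, W[p])` satisfies the Selmer local condition at every place `v ∣ p` (CO-ALIGNMENT, for this class). THEN
`ξ ∈ Sel_p(W/K)`: at a good `v ∤ p` an unramified class is a Kummer class (Milne I 3.8; X11b via w4 g8's
`mem_selmerLocalKer_of_coboundaryOn_inertia_of_good`), at a bad `v ∤ p` the local condition is empty (`H¹(K_v, W[p]) = 0`,
`mem_torsionLocalKer_adicCompletion_of_forall_nsmul_eq_zero`), at the infinite places `p` is odd.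
[cite: MilneADT2006, Ch. I Prop. 3.8 and §6] [cite: SilvermanAEC2009, X.§4 (Thm. 4.2)] [cite: SerreGaloisCohomology1997, I.§2.4 Cor. to Prop. 9] -/
theorem incl_mem_selmerGroup_of_coaligned (p : ℕ) [hp : Fact p.Prime] (hp2 : p ≠ 2)
    (Φ : StableSubgroup (absoluteGaloisGroup K) (geomTorsion W (p : ℤ)))
    (hbad : ∀ v : HeightOneSpectrum (𝓞 K), ¬ W.HasGoodReductionAt v → ((p : ℕ) : 𝓞 K) ∉ v.asIdeal →
      ∀ P : (W.baseChange (v.adicCompletion K)).toAffine.Point, p • P = 0 → P = 0)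
    (w : contOneCocycles (discreteTopRep (absoluteGaloisGroup K) Φ.Sub))
    (hwI : ∀ (v : HeightOneSpectrum (𝓞 K)) (𝔓 : Ideal (absIntegers (𝓞 K) K)), ((p : ℕ) : 𝓞 K) ∉ v.asIdeal →
      𝔓 ∈ v.primesAbove → ∃ s : Φ.Sub, ∀ g ∈ 𝔓.inertia (absoluteGaloisGroup K), w.1 g = g • s - s)
    (hCO : ∀ v : HeightOneSpectrum (𝓞 K), ((p : ℕ) : 𝓞 K) ∈ v.asIdeal →
      oneCocycleClass (discreteTopRep (absoluteGaloisGroup K) (geomTorsion W (p : ℤ)))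
        (contOneCocycles.pullback (ContinuousMonoidHom.id _)
          (resHomOfEquivariant (ContinuousMonoidHom.id _) Φ.incl Φ.incl_smul) w) ∈
        selmerLocalKer W (v.adicCompletion K) (p : ℤ)) :
    oneCocycleClass (discreteTopRep (absoluteGaloisGroup K) (geomTorsion W (p : ℤ)))
      (contOneCocycles.pullback (ContinuousMonoidHom.id _)
        (resHomOfEquivariant (ContinuousMonoidHom.id _) Φ.incl Φ.incl_smul) w) ∈ selmerGroup W (p : ℤ) := by
  set z : contOneCocycles (discreteTopRep (absoluteGaloisGroup K) (geomTorsion W (p : ℤ))) :=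
    contOneCocycles.pullback (ContinuousMonoidHom.id _)
      (resHomOfEquivariant (ContinuousMonoidHom.id _) Φ.incl Φ.incl_smul) w with hzdef
  have hz : ∀ g, z.1 g = Φ.incl (w.1 g) := fun g ↦ rfl
  rw [mem_selmerGroup_iff]
  refine ⟨fun v ↦ ?_, fun w' ↦ mem_selmerLocalKer_infinitePlace_of_odd W (hp.out.odd_of_ne_two hp2) w' _⟩
  by_cases hpv : ((p : ℕ) : 𝓞 K) ∈ v.asIdeal
  · exact hCO v hpv
  by_cases hgood : W.HasGoodReductionAt v
  · obtain ⟨t, ht⟩ := hwI v _ hpv (adicCompletionPrime_mem_primesAbove K v)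
    exact mem_selmerLocalKer_of_coboundaryOn_inertia_of_good W p 1 (by rw [pow_one]) hpv hgood z
      (t := Φ.incl t) fun g hg ↦ by rw [hz, ht g hg, map_sub, StableSubgroup.incl_smul]
  · haveI : NeZero p := ⟨hp.out.ne_zero⟩
    exact W.torsionLocalKer_le_selmerLocalKer (v.adicCompletion K) (p : ℤ)
      (W.mem_torsionLocalKer_adicCompletion_of_forall_nsmul_eq_zero (v := v) p hpv (hbad v hgood hpv) _)

/-! ## §2 CO-ALIGNED ⟹ `#R_rel(Φ.Sub) ≤ #Sel_p(W/K)` -/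

/-- **THE LOWER BOUND: CO-ALIGNED ⟹ `R_rel(Φ) ↪ Sel_p(W/K)`.** `K` a number field, `W/K` elliptic, `p` an odd prime, `Φ ≤ W[p]` a
`Γ_K`-stable subgroup whose QUOTIENT has no non-zero `Γ_K`-invariant; `W(K_v)[p] = 0` at the bad `v ∤ p`; and CO-ALIGNMENT at `p`
along `Φ`: for every continuous crossed homomorphism `w : Γ_K → Φ.Sub` the class `[Φ.incl ∘ w]` satisfies the Selmer local condition
at every place `v ∣ p`. THEN the relaxed residual group of the sub injects into the Selmer group:
**`#h1Unramified Φ.Sub S_p ≤ #Sel_p(W/K)`**, i.e. `dim_𝔽_p Sel_p(W/K) ≥ u_rel(θ_S)`. (The map is `ι_* = H¹(Φ.incl)`; it lands in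
`Sel_p` by §1 and is injective because `H⁰(Γ_K, Φ.Quot) = 0`, w4/w5's `exists_eq_smul_sub_of_push_principal`.) The LOWER companion of
seat g9's `natCard_selmerGroup_le_of_aligned` (`#Sel_p ≤ #R_str(Φ.Quot) · #R_rel(Φ.Sub)`).
[cite: SerreGaloisCohomology1997, I.§2.6 (b) and I.§5.1] [cite: MilneADT2006, Ch. I Prop. 3.8 and §6] [cite: GreenbergLNM1716, §3 (PDF p. 86)] -/
theorem natCard_h1Unramified_le_natCard_selmerGroup_of_coaligned (p : ℕ) [hp : Fact p.Prime] (hp2 : p ≠ 2)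
    (Φ : StableSubgroup (absoluteGaloisGroup K) (geomTorsion W (p : ℤ)))
    (hQΓ : ∀ q : Φ.Quot, (∀ g : absoluteGaloisGroup K, g • q = q) → q = 0)
    (hbad : ∀ v : HeightOneSpectrum (𝓞 K), ¬ W.HasGoodReductionAt v → ((p : ℕ) : 𝓞 K) ∉ v.asIdeal →
      ∀ P : (W.baseChange (v.adicCompletion K)).toAffine.Point, p • P = 0 → P = 0)
    (hCO : ∀ w : contOneCocycles (discreteTopRep (absoluteGaloisGroup K) Φ.Sub),
      ∀ v : HeightOneSpectrum (𝓞 K), ((p : ℕ) : 𝓞 K) ∈ v.asIdeal →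
        oneCocycleClass (discreteTopRep (absoluteGaloisGroup K) (geomTorsion W (p : ℤ)))
          (contOneCocycles.pullback (ContinuousMonoidHom.id _)
            (resHomOfEquivariant (ContinuousMonoidHom.id _) Φ.incl Φ.incl_smul) w) ∈
          selmerLocalKer W (v.adicCompletion K) (p : ℤ)) :
    Nat.card ↥(h1Unramified Φ.Sub {v : HeightOneSpectrum (𝓞 K) | ((p : ℕ) : 𝓞 K) ∈ v.asIdeal}) ≤
      Nat.card (selmerGroup W (p : ℤ)) := by
  have hp0 : ((p : ℕ) : ℤ) ≠ 0 := by exact_mod_cast hp.out.ne_zero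
  haveI : Finite (selmerGroup W (p : ℤ)) := W.finite_selmerGroup_holds hp0
  set Γ := absoluteGaloisGroup K
  set Sp : Set (HeightOneSpectrum (𝓞 K)) := {v | ((p : ℕ) : 𝓞 K) ∈ v.asIdeal} with hSp
  -- `ι_* = H¹(Φ.incl)`
  let ιH : discreteH1 Γ Φ.Sub →+ galH1Torsion W (p : ℤ) :=
    (ContinuousCohomology.map (ContinuousMonoidHom.id Γ)
      (resHomOfEquivariant (ContinuousMonoidHom.id Γ) Φ.incl Φ.incl_smul) 1).hom.toLinearMap.toAddMonoidHom
  have hιH : ∀ w, ιH (oneCocycleClass _ w) = oneCocycleClass (discreteTopRep Γ (geomTorsion W (p : ℤ)))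
      (contOneCocycles.pullback (ContinuousMonoidHom.id Γ)
        (resHomOfEquivariant (ContinuousMonoidHom.id Γ) Φ.incl Φ.incl_smul) w) := fun w ↦
    map_oneCocycleClass _ _ _ w
  -- `ι_*` maps `R_rel(Φ.Sub)` into `Sel_p` (§1)
  have hmem : ∀ c ∈ h1Unramified Φ.Sub Sp, ιH c ∈ selmerGroup W (p : ℤ) := by
    intro c hc
    obtain ⟨w, rfl⟩ := oneCocycleClass_surjective _ c
    rw [hιH]
    refine incl_mem_selmerGroup_of_coaligned W p hp2 Φ hbad w (fun v 𝔓 hpv h𝔓 ↦ ?_) (hCO w)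
    have h := mem_h1Unramified_iff.1 hc v (by simpa [hSp] using hpv) 𝔓 h𝔓
    obtain ⟨s, hs⟩ := (oneCocycleClass_mem_subgroupResKer_iff _ w).1 h
    exact ⟨s, fun g hg ↦ hs ⟨g, hg⟩⟩
  -- `ι_*` is injective (`H⁰(Γ_K, Φ.Quot) = 0`)
  have hker : ∀ m : geomTorsion W (p : ℤ), Φ.proj m = 0 → ∃ s : Φ.Sub, Φ.incl s = m := fun m hm ↦
    ⟨⟨m, (QuotientAddGroup.eq_zero_iff m).mp hm⟩, rfl⟩
  have hπι : ∀ s : Φ.Sub, Φ.proj (Φ.incl s) = 0 := fun s ↦ (QuotientAddGroup.eq_zero_iff _).mpr s.2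
  have hinj : ∀ c, ιH c = 0 → c = 0 := by
    intro c hc
    obtain ⟨w, rfl⟩ := oneCocycleClass_surjective _ c
    rw [hιH, oneCocycleClass_eq_zero_iff] at hc
    obtain ⟨m₀, hm₀⟩ := hc
    obtain ⟨s₀, hs₀⟩ := exists_eq_smul_sub_of_push_principal Φ.incl Φ.proj Φ.incl_smul Φ.proj_smul
      Φ.incl_injective hπι hker hQΓ w.1 (m₀ := m₀) (fun g ↦ by rw [← pullback_id_apply]; exact hm₀ g)
    exact (oneCocycleClass_eq_zero_iff _ w).2 ⟨s₀, hs₀⟩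
  -- count
  refine Nat.card_le_card_of_injective (fun c : ↥(h1Unramified Φ.Sub Sp) ↦
    (⟨ιH c.1, hmem c.1 c.2⟩ : selmerGroup W (p : ℤ))) fun x y hxy ↦ ?_
  simp only [Subtype.mk.injEq] at hxy
  have h0 : ιH (x.1 - y.1) = 0 := by rw [map_sub, hxy, sub_self]
  exact Subtype.ext (sub_eq_zero.1 (hinj _ h0))

end AnyField

/-! ## §3 Over `ℚ`, rank one: `#R_rel(Φ.Sub) ≥ p² ⟹ Ш(W/ℚ)[p] ≠ 0` -/

section Rat

variable (W : WeierstrassCurve ℚ) [W.IsElliptic]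

/-- **`#R_rel(Φ) ≥ p²` ON A CO-ALIGNED RANK-ONE MEMBER FORCES `Ш(W/ℚ)[p] ≠ 0`.** `W/ℚ` elliptic of Mordell–Weil rank `1` with
`W(ℚ)[p] = 0` (`p` odd), `Φ ≤ W[p]` stable with `Φ.Quot^{Γ_ℚ} = 0`, `W(ℚ_ℓ)[p] = 0` at the bad `ℓ ≠ p`, CO-ALIGNED at `p` along `Φ`.
If the relaxed residual group of the sub has at least `p²` elements (`u_rel(θ_S) ≥ 2`), then `Ш(W/ℚ)` contains a NON-ZERO element
killed by `p`: `#Sel_p(W/ℚ) ≥ #R_rel(Φ.Sub) ≥ p²` (§2) while `#Sel_p = p · #Ш[p]` in rank one without `p`-torsion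
(`ParitySplit.natCard_selmerGroup_eq_mul_of_rank_one`). The member is then on LEAD g11's B1-sha branch — ORDER form, not first order.
[cite: SilvermanAEC2009, Thm. X.4.2] [cite: SerreGaloisCohomology1997, I.§2.6 (b) and I.§5.1] [cite: GreenbergLNM1716, §3 (PDF p. 86)] -/
theorem exists_sha_ne_zero_of_coaligned_of_sq_le (p : ℕ) [hp : Fact p.Prime] (hp2 : p ≠ 2)
    (hrank : W.mordellWeilRank = 1) (htors : ∀ P : W.toAffine.Point, p • P = 0 → P = 0)
    (Φ : StableSubgroup (absoluteGaloisGroup ℚ) (geomTorsion W (p : ℤ)))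
    (hQΓ : ∀ q : Φ.Quot, (∀ g : absoluteGaloisGroup ℚ, g • q = q) → q = 0)
    (hbad : ∀ v : HeightOneSpectrum (𝓞 ℚ), ¬ W.HasGoodReductionAt v → ((p : ℕ) : 𝓞 ℚ) ∉ v.asIdeal →
      ∀ P : (W.baseChange (v.adicCompletion ℚ)).toAffine.Point, p • P = 0 → P = 0)
    (hCO : ∀ w : contOneCocycles (discreteTopRep (absoluteGaloisGroup ℚ) Φ.Sub),
      ∀ v : HeightOneSpectrum (𝓞 ℚ), ((p : ℕ) : 𝓞 ℚ) ∈ v.asIdeal →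
        oneCocycleClass (discreteTopRep (absoluteGaloisGroup ℚ) (geomTorsion W (p : ℤ)))
          (contOneCocycles.pullback (ContinuousMonoidHom.id _)
            (resHomOfEquivariant (ContinuousMonoidHom.id _) Φ.incl Φ.incl_smul) w) ∈
          selmerLocalKer W (v.adicCompletion ℚ) (p : ℤ))
    (hsq : p ^ 2 ≤ Nat.card ↥(h1Unramified Φ.Sub {v : HeightOneSpectrum (𝓞 ℚ) | ((p : ℕ) : 𝓞 ℚ) ∈ v.asIdeal})) :
    ∃ c ∈ W.sha, c ≠ 0 ∧ p • c = 0 := by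
  have hle := natCard_h1Unramified_le_natCard_selmerGroup_of_coaligned W p hp2 Φ hQΓ hbad hCO
  have hsel : p ^ 2 ≤ Nat.card (selmerGroup W (p : ℤ)) := hsq.trans hle
  rw [ParitySplit.natCard_selmerGroup_eq_mul_of_rank_one W p hrank htors, pow_two] at hsel
  have hN : p ≤ Nat.card (W.sha ⊓ AddSubgroup.torsionBy W.galH1 p : AddSubgroup W.galH1) :=
    Nat.le_of_mul_le_mul_left hsel hp.out.pos
  have hsha : 1 < Nat.card (W.sha ⊓ AddSubgroup.torsionBy W.galH1 p : AddSubgroup W.galH1) :=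
    hp.out.one_lt.trans_le hN
  haveI : Finite (W.sha ⊓ AddSubgroup.torsionBy W.galH1 p : AddSubgroup W.galH1) :=
    Nat.finite_of_card_ne_zero (by omega)
  obtain ⟨x, y, hxy⟩ := Finite.one_lt_card_iff_nontrivial.mp hsha
  -- one of `x`, `y` is non-zero
  have hx : ∃ z : (W.sha ⊓ AddSubgroup.torsionBy W.galH1 p : AddSubgroup W.galH1), z ≠ 0 := by
    by_cases h : x = 0
    · exact ⟨y, fun hy ↦ hxy (h.trans hy.symm)⟩
    · exact ⟨x, h⟩
  obtain ⟨z, hz⟩ := hx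
  obtain ⟨hzsha, hztor⟩ := AddSubgroup.mem_inf.mp z.2
  refine ⟨z.1, hzsha, fun h ↦ hz (Subtype.ext h), ?_⟩
  exact AddSubgroup.torsionBy.nsmul_iff.mp hztor

/-- **The same on the CM-ramified class, with its landed inputs.** `W/ℚ` globally minimal with CM, `p ≥ 5` ramified in the CM field,
`rank W(ℚ) = 1`, `Φ ≤ W[p]` a stable line of order `p`, CO-ALIGNED at `p` along `Φ`, and `#R_rel(Φ.Sub) ≥ p²`. THEN `Ш(W/ℚ)[p] ≠ 0`.
The class supplies `W(ℚ)[p] = 0` (`LevelDictionary.forall_nsmul_eq_zero_of_cmRamified`), `W(ℚ_ℓ)[p] = 0` at the bad `ℓ ≠ p`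
(`LevelDictionaryAlpha.forall_prime_nsmul_eq_zero_adicCompletion_of_bad`) and `Φ.Quot^{Γ_ℚ} = 0` (the inertia homothety at `p`,
`quot_eq_zero_of_forall_inertia_smul_eq_at_p`). For `Φ.Sub = 𝔽_p(ψ)` (the model `W_ψ`, CASE R) this is the B1-sha locus
«CASE R ∧ EVEN-IRREGULAR» of the first-order census, granted the Greenberg–Wiles count `u_rel(ψ) = 1 + u_str(θ_e)` for `hsq`.
[cite: SilvermanAEC2009, Thm. X.4.2] [cite: GrossLMS1991, §9] [cite: GreenbergLNM1716, §3 (PDF p. 86)] -/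
theorem exists_sha_ne_zero_of_coaligned_of_sq_le_of_cmRamified [W.IsGloballyMinimal] (p : ℕ) [hp : Fact p.Prime]
    (hCM : W.HasCM) (hram : CMRamified W p) (h5 : 5 ≤ p) (hrank : W.mordellWeilRank = 1)
    (Φ : StableSubgroup (absoluteGaloisGroup ℚ) (geomTorsion W (p : ℤ))) (hcard : Nat.card Φ.Sub = p)
    (hCO : ∀ w : contOneCocycles (discreteTopRep (absoluteGaloisGroup ℚ) Φ.Sub),
      ∀ v : HeightOneSpectrum (𝓞 ℚ), ((p : ℕ) : 𝓞 ℚ) ∈ v.asIdeal →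
        oneCocycleClass (discreteTopRep (absoluteGaloisGroup ℚ) (geomTorsion W (p : ℤ)))
          (contOneCocycles.pullback (ContinuousMonoidHom.id _)
            (resHomOfEquivariant (ContinuousMonoidHom.id _) Φ.incl Φ.incl_smul) w) ∈
          selmerLocalKer W (v.adicCompletion ℚ) (p : ℤ))
    (hsq : p ^ 2 ≤ Nat.card ↥(h1Unramified Φ.Sub {v : HeightOneSpectrum (𝓞 ℚ) | ((p : ℕ) : 𝓞 ℚ) ∈ v.asIdeal})) :
    ∃ c ∈ W.sha, c ≠ 0 ∧ p • c = 0 := by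
  have hpr : p.Prime := hp.out
  have hp2 : p ≠ 2 := by omega
  obtain ⟨v, hv⟩ := Literature.NumberTheory.NumberFields.RingOfIntegers.exists_heightOneSpectrum_natCast_mem ℚ hpr
  have hQΓ : ∀ q : Φ.Quot, (∀ g : absoluteGaloisGroup ℚ, g • q = q) → q = 0 := fun q hq ↦
    LevelDictionaryAlpha.quot_eq_zero_of_forall_inertia_smul_eq_at_p W Φ hCM h5 hram hcard hv
      (adicCompletionPrime_mem_primesAbove ℚ v) q fun g _ ↦ hq g
  have hbad : ∀ v' : HeightOneSpectrum (𝓞 ℚ), ¬ W.HasGoodReductionAt v' → ((p : ℕ) : 𝓞 ℚ) ∉ v'.asIdeal →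
      ∀ P : (W.baseChange (v'.adicCompletion ℚ)).toAffine.Point, p • P = 0 → P = 0 :=
    fun v' hg hpv' ↦ LevelDictionaryAlpha.forall_prime_nsmul_eq_zero_adicCompletion_of_bad (K := ℚ) W hCM hram h5 hpv' hg
  have htors : ∀ P : W.toAffine.Point, p • P = 0 → P = 0 := forall_nsmul_eq_zero_of_cmRamified W p hCM h5 hram
  exact exists_sha_ne_zero_of_coaligned_of_sq_le W p hp2 hrank htors Φ hQΓ hbad hCO hsq

end Rat

end Summit.BirchSwinnertonDyer.BirchSwinnertonDyer.Theorems.PrintCFram.SelmerCount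

end
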